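import Summits.QuantumFields.BalabanUV.Beta.SubsolutionMeanValueBox

/-!
# Beta / SubsolutionMeanValueDirichlet — `hreg`'s SHAPE FOR FIELDS VANISHING OFF A REGION (the LOCAL ∕ DIRICHLET inverses of the
# parametrix): the ZERO EXTENSION of the fibre norm is a sub-solution on the WHOLE carrier with the source read on the region only,
# so the mean-value bound needs NO boundary regularity (MODEL; generic bond structure + the torus END; sixth module of
# «LATTICE-DEGIORGI-MV», serving the level-free re-run (w4-d)∕(w4-f) of the O.2 skeleton)

THE POINT.  Node (w4)'s remainder terms carry the LOCAL Dirichlet inverses `G′_Ω₀ = dirInv A Ω₀` of the hulls; a level-free WRS ∕ row-sum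
currency for them ((w4-d)∕(w4-f), O.2 skeleton §8.10) needs the sup member `‖G′_Ω₀u‖_∞ ≲ n²·‖u‖_∞`, i.e. `hreg`'s shape for fields
`f = G′_Ω₀u` that VANISH OFF `Ω₀` and solve the equation ON `Ω₀` only.  Near `∂Ω₀` the source `D*Df` is NOT small — but it need not be:
at a site off `Ω₀` the fibre norm `‖f(x)‖` is `0`, so the sub-solution inequality `W·‖f‖ ≤ N‖f‖ + m′` holds there trivially (`N‖f‖ ≥ 0`,
`m′ ≥ 0`), while on `Ω₀` it is Kato's inequality (file 12) with the source read ON `Ω₀`.  Hence road P3's order bookkeeping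
(`SubsolutionMeanValue.subsolution_le_meanValue_unit`) and this lineage's mean-value binder apply VERBATIM to zero-extended fields.
CONTENT (kernel, 0 sorry): §1 (generic carrier `src tgt : Bd → St`, weights `c`, any column-orthonormal `Rm`)
**`fibreNorm_subsolution_of_vanishing`** (f ≡ 0 off `Ω₀`, `‖(D*Df)(x)‖ ≤ m′` on `B ∩ Ω₀` ⟹ `W·‖f‖ ≤ N‖f‖ + m′` on `B`),
**`fibreNorm_le_meanValue_dirichlet`** (⟹ `‖f(p)‖ ≤ Φ(‖f‖) + m′·w₀(p)` for every mean-value binder `Φ` at `(B,p)` and unit supersolution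
`w₀` on `B`); §2 (unit torus, constant weight `c ≡ c₀ ≠ 0`, `R ≥ 1`, `10R + 4 ≤ N_i`) **`fibreNorm_le_box_dirichlet`**:
`‖f(x₀)‖ ≤ C_d·√((Σ_{dist ≤ R} ‖f‖²)/R^d) + m′·(R+1)²/(2c₀²)` for every `f` vanishing off `Ω₀` with `‖D*Df‖ ≤ m′` on the ball ∩ `Ω₀` —
`SubsolutionMeanValueBox.meanValue_ball` + the owner's `exists_unit_supersolution_box`, NO hypothesis left.
(unit `b2b-balaban-beta-d4-p2`, GEN 10, MODEL crew; claim «LATTICE-DEGIORGI-MV» journal l.22396.)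

HONEST FRAMING: discharging `BetaPertH` makes Bałaban's UV stability UNCONDITIONAL — NOT the continuum limit, NOT the
Clay problem.  HONEST DEPENDENCY (verbatim): «continuum YM on T⁴ ⇐ BetaPertH ∧ nine spine estimates (0/9 proved);
BetaPertH ⇐ (D1) ∧ (D4) ∧ CAP+tail; G-an2-4 gates asym, D1 and NE2/3/4.»  THIS MODULE DISCHARGES NOTHING of `BetaPertH`,
asserts NOTHING printed and cites nothing as a fact (ABSOLUTE RULE): [folklore] order bookkeeping; nothing of Bałaban's G′(U) is
instantiated.  LOCATORS (shape only): [Balaban1985BackgroundPropagators] (3.87)–(3.90) pp. 408–409 (the local inverses `G′_{Ω₀(□)}`),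
Thm 3.1 (3.42) p. 397.  No class change on row D4 (critical-path width 0; D4 DISCHARGE NO DATE); NOT BetaPertH, NOT continuum, NOT Clay.
-/

open scoped BigOperators
open Finset

namespace Summit.QuantumFields.BalabanUV.Beta.SubsolutionMeanValueDirichlet

open Literature.MathematicalPhysics.QuantumFieldTheory.Balaban1983to89
open Literature.MathematicalPhysics.QuantumFieldTheory.Balaban1983to89.B9Thm37Glue (covD covDT)
open Literature.MathematicalPhysics.QuantumFieldTheory.Balaban1983to89.B9Thm37GluePU (bsrc btgt)
open B5TorusCover (UT)
open Summit.QuantumFields.BalabanUV.Beta.CovariantKato (kato_covLap)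
open Summit.QuantumFields.BalabanUV.Beta.SubsolutionMeanValue (nb_nonneg subsolution_le_meanValue_unit)
open Summit.QuantumFields.BalabanUV.Beta.SubsolutionMeanValueBox (Cmv Cmv_pos meanValue_ball mono_meanValue)
open Summit.QuantumFields.BalabanUV.Beta.TorusBoxSupersolution (exists_unit_supersolution_box)

noncomputable section

/-! ## §1 Zero-extended fields are sub-solutions with the source read on the region -/

section Generic

variable {St Bd : Type} [Fintype Bd] [DecidableEq St] (src tgt : Bd → St) (c : Bd → ℝ)

/-- **THE ZERO EXTENSION IS A SUB-SOLUTION**: if `f` vanishes off `Ω₀` and `‖(D*Df)(x)‖ ≤ m′` (`m′ ≥ 0`) at the sites of `B` inside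
`Ω₀`, then the fibre norm `u = ‖f‖` satisfies `W·u ≤ Nu + m′` at EVERY site of `B` (Kato on `Ω₀`; `u = 0` off `Ω₀`). [folklore] -/
theorem fibreNorm_subsolution_of_vanishing {Cp : Type} [Fintype Cp] [DecidableEq Cp] (Rm : Bd → Cp → Cp → ℝ)
    (hRm : ∀ b i j, ∑ k, Rm b k i * Rm b k j = if i = j then (1 : ℝ) else 0) (f : St × Cp → ℝ)
    (Ω₀ : St → Prop) (hzero : ∀ x, ¬ Ω₀ x → ∀ i, f (x, i) = 0) (B : Finset St) {m' : ℝ} (hm' : 0 ≤ m')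
    (hsrc : ∀ x ∈ B, Ω₀ x → Real.sqrt (∑ i, (covDT src tgt c Rm (covD src tgt c Rm f) (x, i)) ^ 2) ≤ m') :
    ∀ x ∈ B, ((∑ b ∈ univ.filter (fun b => tgt b = x), c b ^ 2) + ∑ b ∈ univ.filter (fun b => src b = x), c b ^ 2) *
        Real.sqrt (∑ i, f (x, i) ^ 2) ≤
      ((∑ b ∈ univ.filter (fun b => tgt b = x), c b ^ 2 * Real.sqrt (∑ i, f (src b, i) ^ 2)) +
          ∑ b ∈ univ.filter (fun b => src b = x), c b ^ 2 * Real.sqrt (∑ i, f (tgt b, i) ^ 2)) + m' := by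
  intro x hx
  by_cases hΩ : Ω₀ x
  · have hk := kato_covLap src tgt c Rm hRm f x
    have hs := hsrc x hx hΩ
    linarith
  · have h0 : Real.sqrt (∑ i, f (x, i) ^ 2) = 0 := by
      have : ∑ i, f (x, i) ^ 2 = 0 := Finset.sum_eq_zero fun i _ => by rw [hzero x hΩ i]; ring
      rw [this, Real.sqrt_zero]
    rw [h0, mul_zero]
    exact add_nonneg (nb_nonneg src tgt c (u := fun y => Real.sqrt (∑ i, f (y, i) ^ 2)) (fun _ => Real.sqrt_nonneg _) x) hm'

/-- **`hreg`'s SHAPE FOR ZERO-EXTENDED FIELDS, from the mean-value binder alone**: under the hypotheses of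
`fibreNorm_subsolution_of_vanishing`, for every monotone mean-value functional `Φ` satisfying the binder at `(B, p)` and every nonnegative
unit supersolution `w₀` on `B`: `‖f(p)‖ ≤ Φ(‖f‖) + m′·w₀(p)` — road P3's `subsolution_le_meanValue_unit` BY NAME. [folklore] -/
theorem fibreNorm_le_meanValue_dirichlet {Cp : Type} [Fintype Cp] [DecidableEq Cp] (Rm : Bd → Cp → Cp → ℝ)
    (hRm : ∀ b i j, ∑ k, Rm b k i * Rm b k j = if i = j then (1 : ℝ) else 0) (f : St × Cp → ℝ)
    (Ω₀ : St → Prop) (hzero : ∀ x, ¬ Ω₀ x → ∀ i, f (x, i) = 0) (B : Finset St) (p : St) (Φ : (St → ℝ) → ℝ)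
    (hΦ : ∀ z z' : St → ℝ, (∀ y, 0 ≤ z y) → (∀ y, z y ≤ z' y) → Φ z ≤ Φ z')
    (hMV : ∀ z : St → ℝ, (∀ y, 0 ≤ z y) →
      (∀ x ∈ B, ((∑ b ∈ univ.filter (fun b => tgt b = x), c b ^ 2) + ∑ b ∈ univ.filter (fun b => src b = x), c b ^ 2) * z x ≤
        ((∑ b ∈ univ.filter (fun b => tgt b = x), c b ^ 2 * z (src b)) + ∑ b ∈ univ.filter (fun b => src b = x), c b ^ 2 * z (tgt b))) →
      z p ≤ Φ z)
    (w₀ : St → ℝ) (hw₀0 : ∀ y, 0 ≤ w₀ y)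
    (hw₀ : ∀ x ∈ B, 1 + ((∑ b ∈ univ.filter (fun b => tgt b = x), c b ^ 2 * w₀ (src b)) +
        ∑ b ∈ univ.filter (fun b => src b = x), c b ^ 2 * w₀ (tgt b)) ≤
      ((∑ b ∈ univ.filter (fun b => tgt b = x), c b ^ 2) + ∑ b ∈ univ.filter (fun b => src b = x), c b ^ 2) * w₀ x)
    {m' : ℝ} (hm' : 0 ≤ m')
    (hsrc : ∀ x ∈ B, Ω₀ x → Real.sqrt (∑ i, (covDT src tgt c Rm (covD src tgt c Rm f) (x, i)) ^ 2) ≤ m') :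
    Real.sqrt (∑ i, f (p, i) ^ 2) ≤ Φ (fun x => Real.sqrt (∑ i, f (x, i) ^ 2)) + m' * w₀ p :=
  subsolution_le_meanValue_unit src tgt c B p Φ hΦ hMV w₀ hw₀0 hw₀ (fun x => Real.sqrt (∑ i, f (x, i) ^ 2)) (fun _ => m')
    (fun _ => Real.sqrt_nonneg _) hm' (fun _ _ => le_rfl)
    (fibreNorm_subsolution_of_vanishing src tgt c Rm hRm f Ω₀ hzero B hm' hsrc)

end Generic

/-! ## §2 The torus END: the LOCAL-inverse shape, hypothesis-free -/

section Torus

variable {d : ℕ} {N : Fin d → ℕ} [∀ i, NeZero (N i)]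

/-- **`hreg`'s SHAPE FOR A FIELD VANISHING OFF A REGION OF THE TORUS (the Dirichlet ∕ local inverses), NO HYPOTHESIS LEFT.**  Unit torus
(`d ≥ 1`), bonds `bsrc∕btgt`, constant weight `c ≡ c₀ ≠ 0`, ANY column-orthonormal `Rm`, centre `x₀`, radius `R ≥ 1` with `10R + 4 ≤ N_i`;
`f` vanishes off `Ω₀` and `‖(D*Df)(x)‖ ≤ m′` (`m′ ≥ 0`) at the sites of the ball `dist(·, x₀) ≤ R` that lie in `Ω₀`.  Then
`√(Σ_i f(x₀,i)²) ≤ C_d·√((Σ_{dist ≤ R} Σ_i f(x,i)²)/R^d) + m′·(R+1)²/(2c₀²)`. [folklore] -/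
theorem fibreNorm_le_box_dirichlet [NeZero d] {Cp : Type} [Fintype Cp] [DecidableEq Cp] {c : UT N × Fin d → ℝ} {c₀ : ℝ}
    (hc : ∀ b, c b = c₀) (hc₀ : c₀ ≠ 0) (Rm : UT N × Fin d → Cp → Cp → ℝ)
    (hRm : ∀ b i j, ∑ k, Rm b k i * Rm b k j = if i = j then (1 : ℝ) else 0) (f : UT N × Cp → ℝ)
    (Ω₀ : UT N → Prop) (hzero : ∀ x, ¬ Ω₀ x → ∀ i, f (x, i) = 0)
    (x₀ : UT N) {R : ℕ} (hR : 1 ≤ R) (hN : ∀ i, 10 * R + 4 ≤ N i) {m' : ℝ} (hm' : 0 ≤ m')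
    (hsrc : ∀ x ∈ univ.filter (fun x : UT N => dist x x₀ ≤ R), Ω₀ x →
      Real.sqrt (∑ i, (covDT bsrc btgt c Rm (covD bsrc btgt c Rm f) (x, i)) ^ 2) ≤ m') :
    Real.sqrt (∑ i, f (x₀, i) ^ 2) ≤
      Cmv d * Real.sqrt ((∑ x ∈ univ.filter (fun x : UT N => dist x x₀ ≤ R), ∑ i, f (x, i) ^ 2) / (R : ℝ) ^ d) +
        m' * (((R : ℝ) + 1) ^ 2 / (2 * c₀ ^ 2)) := by
  have hd1 : 1 ≤ d := Nat.one_le_iff_ne_zero.mpr (NeZero.ne d)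
  have hr2 : ∀ μ, 2 * R + 2 ≤ N μ := fun μ => by have := hN μ; omega
  obtain ⟨w₀, h0, hle, hsup⟩ := exists_unit_supersolution_box hc hc₀ x₀ hr2
  have hC0 : 0 ≤ Cmv d := (Cmv_pos hd1).le
  have h := fibreNorm_le_meanValue_dirichlet bsrc btgt c Rm hRm f Ω₀ hzero (univ.filter (fun x : UT N => dist x x₀ ≤ R)) x₀
    (fun z => Cmv d * Real.sqrt ((∑ x ∈ univ.filter (fun x : UT N => dist x x₀ ≤ R), z x ^ 2) / (R : ℝ) ^ d))
    (fun z z' hz hzz' => mono_meanValue _ hC0 (by positivity) z z' hz hzz')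
    (fun z hz0 hz => meanValue_ball hc hc₀ x₀ hR hN z hz0 hz) w₀ h0 hsup hm' hsrc
  have hsq : ∀ x, Real.sqrt (∑ i, f (x, i) ^ 2) ^ 2 = ∑ i, f (x, i) ^ 2 :=
    fun x => Real.sq_sqrt (Finset.sum_nonneg fun _ _ => sq_nonneg _)
  simp only [hsq] at h
  have h2 := mul_le_mul_of_nonneg_left (hle x₀) hm'
  linarith

end Torus

end

end Summit.QuantumFields.BalabanUV.Beta.SubsolutionMeanValueDirichlet
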